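import Literature.NumberTheory.EllipticCurves.KubertTateFiveMuDescentBox
import Literature.NumberTheory.EllipticCurves.KubertTateFiveRationalTorsion
import HarnessLib

/-!
# `t₅ = 0` at rank `2` by descent alone: the Kubert–Tate curve `E_{-91/9} = [100, 819, 7371, 0, 0]`

PROOF-ONLY file (theorems only, no definition, no named fact, no `sorry`), topic `NumberTheory/EllipticCurves`; an INSTANCE
of the `μ₅`-descent box criterion (`KubertTateMuDescent.shaCorank_five_eq_zero_of_matrix` and siblings) on the Kubert–Tate
`X₁(5)`-family `E_{m,n} : y² + (n − m)xy − mn²y = x³ − mnx²`, at `(m, n) = (-91, 9)`: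

  `E = E_{-91/9} = kubertTateFive (-91) 9 = [100, 819, 7371, 0, 0]`, i.e. `y ^ 2 + 100 * x * y + 7371 * y = x ^ 3 + 819 * x ^ 2`,
  `Δ = -3¹⁰·7⁵·13⁵·17209 = (mn)⁵ (m² − 11mn − n²)`, `T = (0,0)` of order `5`, `5` good.

TAME: `5 ∤ Δ` and the bad primes `3, 7, 13, 17209` are `≢ 1 (mod 5)` (and GAUSSIAN-tame: `17209 ≡ 4 (mod 5)` is `≡ 1 (mod 4)`).
BOX: `S = {3, 7, 13}` (`ω(mn) = 3`); the rational points `−T = (0, -7371)`, `(-60, 1104)`, `(-585, -1521)` have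
`f_T = xy − 9x² + 81y` equal to `-597051 = -3⁸·7·13`, `-9216 = -2¹⁰·3²`, `-2313441 = -3⁴·13⁴`; the base point `2T = (-819, 74529)` has
`f_T = -61039251 = -3⁴·7³·13³`; the `3×3` matrix of valuation differences mod `5`, `M = [[4, 3, 3], [3, 2, 2], [0, 2, 1]]`, is invertible
mod `5` (inverse `[[3, 3, 0], [2, 4, 1], [1, 2, 4]]`). Hence, with NO `L`-function, `p`-adic or conjectural input:

* `shaCorank_five_eq_zero` — **`t₅(E_{-91/9}) = 0`**; `sha_torsionBy_five_eq_bot`; `primaryComponent_sha_five_eq_bot`;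
* `mordellWeilRank_eq` — **`rank E_{-91/9}(ℚ) = 2`** (`#E(ℚ)[5] = 5` by reduction modulo `2`).

`mn = -819 = -3²·7·13` with `13 ≡ 1 (mod 4)` SPLIT in `ℤ[i]` (`ω₁ = 1`): the quadratic twist by `-1` has rank `1` and `t₅ = 0` by the
class-wide Gaussian criterion (sequel `KubertTateM919GaussianTwist`).  BSD is not proved by this.

## References

* [SilvermanAEC2009] J. H. Silverman, *AEC*, 2nd ed., Thm. X.4.2, Prop. X.4.9, Exercise 10.1, Thm. X.1.1, VII.3.1(b).
* [Fisher2001FiveSevenDescent] T. Fisher, JEMS 3 (2001), §§1–2 (the family; this member and its points are ours).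
* [Kubert1976] D. S. Kubert, *Universal bounds on the torsion of elliptic curves*, Table 3 (`N = 5`).
-/

noncomputable section

open scoped AddSubgroup
open WeierstrassCurve
open Literature.NumberTheory.EllipticCurves Literature.NumberTheory.EllipticCurves.KubertTateVelu

namespace Literature.NumberTheory.EllipticCurves

namespace KubertTateM919Descent

/-! ## §1 The curve: coefficients, discriminant, tameness -/

/-- `E_{-91/9} = [100, 819, 7371, 0, 0]`. [cite: Kubert1976, Table 3 (N = 5)] -/
theorem curve_eq : kubertTateFive (((-91 : ℤ) : ℚ)) (((9 : ℤ) : ℚ)) = ⟨100, 819, 7371, 0, 0⟩ := by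
  ext <;> simp [kubertTateFive] <;> norm_num

/-- `Δ(E_{-91/9}) = -6341253914065943691 = -3¹⁰·7⁵·13⁵·17209` (integer model). [cite: Kubert1976, Table 3 (N = 5)] -/
theorem Δ_int : (kubertTateFive (-91 : ℤ) 9).Δ = -6341253914065943691 := by
  rw [kubertTateFive_Δ]; norm_num

/-- `E_{-91/9}` is an elliptic curve (`Δ ≠ 0`). [cite: Kubert1976, Table 3 (N = 5)] -/
theorem isElliptic : (kubertTateFive (((-91 : ℤ) : ℚ)) (((9 : ℤ) : ℚ))).IsElliptic := by
  refine ⟨isUnit_iff_ne_zero.mpr ?_⟩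
  rw [eq_map_int (-91) 9, map_Δ, Δ_int]
  norm_num

/-- `5 ∤ Δ`: good reduction at `5`. [cite: Fisher2001FiveSevenDescent, §2] -/
theorem not_five_dvd_Δ : ¬ (5 : ℤ) ∣ (kubertTateFive (-91 : ℤ) 9).Δ := by
  rw [Δ_int]; norm_num

/-- `2 ∤ Δ`: good reduction at `2` (used for the rational torsion). [cite: SilvermanAEC2009, VII.3.1(b)] -/
theorem not_tor_dvd_Δ : ¬ ((2 : ℕ) : ℤ) ∣ (kubertTateFive (-91 : ℤ) 9).Δ := by
  rw [Δ_int]; norm_num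

/-- **TAME**: every bad prime (`3, 7, 13, 17209`) is `≢ 1 (mod 5)`. [cite: Fisher2001FiveSevenDescent, §2] -/
theorem tame : ∀ p : ℕ, p.Prime → (p : ℤ) ∣ (kubertTateFive (-91 : ℤ) 9).Δ → p % 5 ≠ 1 := by
  intro p hp hdvd
  rw [Δ_int] at hdvd
  have hdvdN : p ∣ 3 ^ 10 * 7 ^ 5 * 13 ^ 5 * 17209 := by
    have h' : (p : ℤ) ∣ ((3 ^ 10 * 7 ^ 5 * 13 ^ 5 * 17209 : ℕ) : ℤ) := by
      have e : ((3 ^ 10 * 7 ^ 5 * 13 ^ 5 * 17209 : ℕ) : ℤ) = 6341253914065943691 := by norm_num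
      rw [e]; exact (Int.dvd_neg.mpr hdvd)
    exact Int.natCast_dvd_natCast.mp h'
  have hpi := Nat.Prime.prime hp
  rcases hpi.dvd_or_dvd hdvdN with h | h
  · rcases hpi.dvd_or_dvd h with h | h
    · rcases hpi.dvd_or_dvd h with h | h
      · have := (Nat.prime_dvd_prime_iff_eq hp Nat.prime_three).mp (hpi.dvd_of_dvd_pow h); omega
      · have := (Nat.prime_dvd_prime_iff_eq hp (by norm_num : Nat.Prime 7)).mp (hpi.dvd_of_dvd_pow h); omega
    · have := (Nat.prime_dvd_prime_iff_eq hp (by norm_num : Nat.Prime 13)).mp (hpi.dvd_of_dvd_pow h); omega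
  · have := (Nat.prime_dvd_prime_iff_eq hp (by norm_num : Nat.Prime 17209)).mp h; omega

/-- **GAUSSIAN-TAME**: every bad prime `ℓ` has `ℓ ≢ 1 (mod 5)` and `ℓ ≡ 4 (mod 5) ⇒ ℓ ≡ 1 (mod 4)`
(`17209 ≡ 4 (mod 5)`, `17209 ≡ 1 (mod 4)`). [cite: Fisher2001FiveSevenDescent, §2] -/
theorem gaussian_tame : ∀ p : ℕ, p.Prime → (p : ℤ) ∣ (kubertTateFive (-91 : ℤ) 9).Δ →
    p % 5 ≠ 1 ∧ (p % 5 = 4 → p % 4 = 1) := by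
  intro p hp hdvd
  refine ⟨tame p hp hdvd, fun h4 ↦ ?_⟩
  rw [Δ_int] at hdvd
  have hdvdN : p ∣ 3 ^ 10 * 7 ^ 5 * 13 ^ 5 * 17209 := by
    have h' : (p : ℤ) ∣ ((3 ^ 10 * 7 ^ 5 * 13 ^ 5 * 17209 : ℕ) : ℤ) := by
      have e : ((3 ^ 10 * 7 ^ 5 * 13 ^ 5 * 17209 : ℕ) : ℤ) = 6341253914065943691 := by norm_num
      rw [e]; exact (Int.dvd_neg.mpr hdvd)
    exact Int.natCast_dvd_natCast.mp h'
  have hpi := Nat.Prime.prime hp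
  rcases hpi.dvd_or_dvd hdvdN with h | h
  · rcases hpi.dvd_or_dvd h with h | h
    · rcases hpi.dvd_or_dvd h with h | h
      · have := (Nat.prime_dvd_prime_iff_eq hp Nat.prime_three).mp (hpi.dvd_of_dvd_pow h); omega
      · have := (Nat.prime_dvd_prime_iff_eq hp (by norm_num : Nat.Prime 7)).mp (hpi.dvd_of_dvd_pow h); omega
    · have := (Nat.prime_dvd_prime_iff_eq hp (by norm_num : Nat.Prime 13)).mp (hpi.dvd_of_dvd_pow h); omega
  · have := (Nat.prime_dvd_prime_iff_eq hp (by norm_num : Nat.Prime 17209)).mp h; omega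

/-- `S = ` the prime factors of `|mn| = 819`: `{3, 7, 13}`. [folklore] -/
private theorem primeFactors_eq : ((-91 : ℤ) * 9).natAbs.primeFactors = {3, 7, 13} := by
  have e : ((-91 : ℤ) * 9).natAbs = 3 ^ 2 * 7 * 13 := by norm_num
  rw [e]
  ext p
  simp only [Nat.mem_primeFactors, Finset.mem_insert, Finset.mem_singleton]
  constructor
  · rintro ⟨hp, hdvd, -⟩
    have hpi := Nat.Prime.prime hp
    rcases hpi.dvd_or_dvd hdvd with h | h
    · rcases hpi.dvd_or_dvd h with h | h
      · exact Or.inl ((Nat.prime_dvd_prime_iff_eq hp Nat.prime_three).mp (hpi.dvd_of_dvd_pow h))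
      · exact Or.inr (Or.inl ((Nat.prime_dvd_prime_iff_eq hp (by norm_num : Nat.Prime 7)).mp h))
    · exact Or.inr (Or.inr ((Nat.prime_dvd_prime_iff_eq hp (by norm_num : Nat.Prime 13)).mp h))
  · rintro (rfl | rfl | rfl) <;> norm_num

/-! ## §2 The affine equation and the points -/

/-- The affine equation of `E_{-91/9}`: `y ^ 2 + 100 * x * y + 7371 * y = x ^ 3 + 819 * x ^ 2`. [cite: Kubert1976, Table 3 (N = 5)] -/
theorem nonsingular_iff (x y : ℚ) :
    (kubertTateFive (((-91 : ℤ) : ℚ)) (((9 : ℤ) : ℚ))).toAffine.Nonsingular x y ↔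
      y ^ 2 + 100 * x * y + 7371 * y = x ^ 3 + 819 * x ^ 2 := by
  have hΔ : (kubertTateFive (((-91 : ℤ) : ℚ)) (((9 : ℤ) : ℚ))).Δ ≠ 0 := isElliptic.isUnit.ne_zero
  rw [← Affine.equation_iff_nonsingular_of_Δ_ne_zero hΔ, Affine.equation_iff]
  simp only [kubertTateFive_a₁, kubertTateFive_a₂, kubertTateFive_a₃, kubertTateFive_a₄,
    kubertTateFive_a₆]
  push_cast
  constructor <;> intro h <;> linear_combination h

/-- The points `−T = (0, -7371)`, `(-60, 1104)`, `(-585, -1521)` and the base point `2T = (-819, 74529)` lie on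
`E_{-91/9}` (checked by `norm_num`). [folklore] -/
private theorem nonsingular_points :
    (kubertTateFive (((-91 : ℤ) : ℚ)) (((9 : ℤ) : ℚ))).toAffine.Nonsingular 0 (-7371) ∧
    (kubertTateFive (((-91 : ℤ) : ℚ)) (((9 : ℤ) : ℚ))).toAffine.Nonsingular (-60) 1104 ∧
    (kubertTateFive (((-91 : ℤ) : ℚ)) (((9 : ℤ) : ℚ))).toAffine.Nonsingular (-585) (-1521) ∧
    (kubertTateFive (((-91 : ℤ) : ℚ)) (((9 : ℤ) : ℚ))).toAffine.Nonsingular (-819) 74529 := by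
  refine ⟨(nonsingular_iff _ _).mpr ?_, (nonsingular_iff _ _).mpr ?_, (nonsingular_iff _ _).mpr ?_,
    (nonsingular_iff _ _).mpr ?_⟩ <;> norm_num

/-! ## §3 The valuation matrix -/

/-- `v_p(± p^k u) = k` for `p ∤ u` (evaluation of `padicValRat` on a factorised integer). [folklore] -/
private theorem padicValRat_eq_of_eq {p : ℕ} [hp : Fact p.Prime] {a : ℚ} (k : ℕ) {u : ℕ} (s : ℤ)
    (hs : s = 1 ∨ s = -1) (hu : ¬ p ∣ u) (h : a = s * (p : ℚ) ^ k * u) : padicValRat p a = k := by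
  have hu0 : u ≠ 0 := by rintro rfl; exact hu (dvd_zero p)
  have hp0 : (p : ℚ) ≠ 0 := Nat.cast_ne_zero.mpr hp.out.ne_zero
  have hs0 : (s : ℚ) ≠ 0 := by rcases hs with rfl | rfl <;> norm_num
  have hsv : padicValRat p (s : ℚ) = 0 := by
    rcases hs with rfl | rfl
    · simp
    · rw [Int.cast_neg, Int.cast_one, padicValRat.neg, padicValRat.one]
  rw [h, padicValRat.mul (mul_ne_zero hs0 (pow_ne_zero _ hp0)) (Nat.cast_ne_zero.mpr hu0),
    padicValRat.mul hs0 (pow_ne_zero _ hp0), hsv, padicValRat.pow (p : ℚ),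
    padicValRat.self hp.out.one_lt, padicValRat.of_nat, padicValNat.eq_zero_of_not_dvd hu]
  simp

/-- The `f_T`-values `f_T = xy − 9x² + 81y` of the points (`-597051`, `-9216`, `-2313441`) and of the base
point `2T` (`-61039251`). [cite: SilvermanAEC2009, Exercise 10.1(c)] -/
theorem kummerValues :
    (∀ i : Fin 3, ![(0 : ℚ), -60, -585] i * ![(-7371 : ℚ), 1104, -1521] i - (((9 : ℤ) : ℚ)) * ![(0 : ℚ), -60, -585] i ^ 2 +
      (((9 : ℤ) : ℚ)) ^ 2 * ![(-7371 : ℚ), 1104, -1521] i = ![(-597051 : ℚ), -9216, -2313441] i) ∧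
    ((-819 : ℚ) * 74529 - (((9 : ℤ) : ℚ)) * (-819) ^ 2 + (((9 : ℤ) : ℚ)) ^ 2 * 74529 = (-61039251 : ℚ)) := by
  refine ⟨fun i ↦ ?_, by norm_num⟩
  fin_cases i <;> simp <;> norm_num

/-- The valuations at `S = (3, 7, 13)`: rows `[[8, 1, 1], [2, 0, 0], [4, 0, 4]]` for the points and `[4, 3, 3]` for the
base point `2T`. [cite: SilvermanAEC2009, Exercise 10.1(c)] -/
theorem valuations :
    (∀ i j : Fin 3, padicValRat (![3, 7, 13] j) (![(-597051 : ℚ), -9216, -2313441] i) =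
      ((![![8, 1, 1], ![2, 0, 0], ![4, 0, 4]] i j : ℕ) : ℤ)) ∧
    (∀ j : Fin 3, padicValRat (![3, 7, 13] j) ((-61039251 : ℚ)) = ((![4, 3, 3] j : ℕ) : ℤ)) := by
  haveI : Fact (Nat.Prime 3) := ⟨Nat.prime_three⟩
  haveI : Fact (Nat.Prime 7) := ⟨by norm_num⟩
  haveI : Fact (Nat.Prime 13) := ⟨by norm_num⟩
  refine ⟨fun i j ↦ ?_, fun j ↦ ?_⟩
  · fin_cases i <;> fin_cases j
    · exact padicValRat_eq_of_eq (p := 3) 8 (u := 91) (-1) (Or.inr rfl) (by norm_num) (by norm_num)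
    · exact padicValRat_eq_of_eq (p := 7) 1 (u := 85293) (-1) (Or.inr rfl) (by norm_num) (by norm_num)
    · exact padicValRat_eq_of_eq (p := 13) 1 (u := 45927) (-1) (Or.inr rfl) (by norm_num) (by norm_num)
    · exact padicValRat_eq_of_eq (p := 3) 2 (u := 1024) (-1) (Or.inr rfl) (by norm_num) (by norm_num)
    · exact padicValRat_eq_of_eq (p := 7) 0 (u := 9216) (-1) (Or.inr rfl) (by norm_num) (by norm_num)
    · exact padicValRat_eq_of_eq (p := 13) 0 (u := 9216) (-1) (Or.inr rfl) (by norm_num) (by norm_num)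
    · exact padicValRat_eq_of_eq (p := 3) 4 (u := 28561) (-1) (Or.inr rfl) (by norm_num) (by norm_num)
    · exact padicValRat_eq_of_eq (p := 7) 0 (u := 2313441) (-1) (Or.inr rfl) (by norm_num) (by norm_num)
    · exact padicValRat_eq_of_eq (p := 13) 4 (u := 81) (-1) (Or.inr rfl) (by norm_num) (by norm_num)
  · fin_cases j
    · exact padicValRat_eq_of_eq (p := 3) 4 (u := 753571) (-1) (Or.inr rfl) (by norm_num) (by norm_num)
    · exact padicValRat_eq_of_eq (p := 7) 3 (u := 177957) (-1) (Or.inr rfl) (by norm_num) (by norm_num)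
    · exact padicValRat_eq_of_eq (p := 13) 3 (u := 27783) (-1) (Or.inr rfl) (by norm_num) (by norm_num)

/-- **The valuation matrix mod `5` is invertible**: with `M_{ij} = v_{q_j} f_T(P_i) − v_{q_j} f_T(2T)`,
`M = [[4, 3, 3], [3, 2, 2], [0, 2, 1]]` mod `5` and `[[3, 3, 0], [2, 4, 1], [1, 2, 4]] · M = 1`, so `c ↦ c M` is onto
`(ℤ/5)^3`. [folklore] -/
private theorem matrix_surjective : ∀ e : Fin 3 → ZMod 5, ∃ c : Fin 3 → ZMod 5, Matrix.vecMul c (Matrix.of (fun i j : Fin 3 ↦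
      ((padicValRat (![3, 7, 13] j) (![(0 : ℚ), -60, -585] i * ![(-7371 : ℚ), 1104, -1521] i -
          (((9 : ℤ) : ℚ)) * ![(0 : ℚ), -60, -585] i ^ 2 + (((9 : ℤ) : ℚ)) ^ 2 * ![(-7371 : ℚ), 1104, -1521] i) -
        padicValRat (![3, 7, 13] j) ((-819 : ℚ) * 74529 - (((9 : ℤ) : ℚ)) * (-819) ^ 2 +
          (((9 : ℤ) : ℚ)) ^ 2 * 74529) : ℤ) : ZMod 5))) = e := by
  have hM : Matrix.of (fun i j : Fin 3 ↦
      ((padicValRat (![3, 7, 13] j) (![(0 : ℚ), -60, -585] i * ![(-7371 : ℚ), 1104, -1521] i -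
          (((9 : ℤ) : ℚ)) * ![(0 : ℚ), -60, -585] i ^ 2 + (((9 : ℤ) : ℚ)) ^ 2 * ![(-7371 : ℚ), 1104, -1521] i) -
        padicValRat (![3, 7, 13] j) ((-819 : ℚ) * 74529 - (((9 : ℤ) : ℚ)) * (-819) ^ 2 +
          (((9 : ℤ) : ℚ)) ^ 2 * 74529) : ℤ) : ZMod 5)) =
      !![4, 3, 3; 3, 2, 2; 0, 2, 1] := by
    ext i j
    simp only [Matrix.of_apply]
    rw [kummerValues.1 i, kummerValues.2, valuations.1 i j, valuations.2 j]
    fin_cases i <;> fin_cases j <;> decide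
  have hinv : (!![3, 3, 0; 2, 4, 1; 1, 2, 4] : Matrix (Fin 3) (Fin 3) (ZMod 5)) *
      !![4, 3, 3; 3, 2, 2; 0, 2, 1] = 1 := by decide
  intro e
  refine ⟨Matrix.vecMul e !![3, 3, 0; 2, 4, 1; 1, 2, 4], ?_⟩
  rw [hM, Matrix.vecMul_vecMul, hinv, Matrix.vecMul_one]

/-- `S` is enumerated by `![3, 7, 13]`. [folklore] -/
private theorem primeFactors_enum :
    (∀ j : Fin 3, ![3, 7, 13] j ∈ ((-91 : ℤ) * 9).natAbs.primeFactors) ∧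
    (∀ p ∈ ((-91 : ℤ) * 9).natAbs.primeFactors, ∃ j : Fin 3, ![3, 7, 13] j = p) := by
  refine ⟨fun j ↦ ?_, fun p hp ↦ ?_⟩
  · rw [primeFactors_eq]; fin_cases j <;> simp
  · rw [primeFactors_eq] at hp
    simp only [Finset.mem_insert, Finset.mem_singleton] at hp
    rcases hp with rfl | rfl | rfl
    · exact ⟨0, rfl⟩
    · exact ⟨1, rfl⟩
    · exact ⟨2, rfl⟩

/-! ## §4 The theorems -/

/-- **`t₅(E_{-91/9}) = 0`: `corank_{ℤ₅} Ш(E_{-91/9}/ℚ)[5^∞] = 0`, UNCONDITIONALLY**, by the complete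
`5`-descent (`μ₅`-side box criterion of `KubertTateMuDescent`, tame régime, `3` points, rank `2`).
[cite: SilvermanAEC2009, Thm. X.4.2(a)] [cite: Fisher2001FiveSevenDescent, §2] -/
theorem shaCorank_five_eq_zero :
    haveI := isElliptic
    (kubertTateFive (((-91 : ℤ) : ℚ)) (((9 : ℤ) : ℚ))).shaCorank 5 = 0 := by
  haveI := isElliptic
  haveI : Fact (Nat.Prime 2) := ⟨Nat.prime_two⟩
  obtain ⟨h1, h2, h3, hb⟩ := nonsingular_points
  exact KubertTateMuDescent.shaCorank_five_eq_zero_of_matrix (-91) 9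
    (toGeomPoints _ (.some (-60) 1104 h2)) (fun σ ↦ smul_toGeomPoints _ σ _)
    (KubertTateFiveTorsion.twentyfive_zsmul_toGeomPoints_ne_zero (-91) 9 2 (by norm_num) (by norm_num)
      not_tor_dvd_Δ (by norm_num) (by norm_num))
    not_five_dvd_Δ tame ![3, 7, 13] primeFactors_enum.1 primeFactors_enum.2
    ![0, -60, -585] ![-7371, 1104, -1521]
    (fun i ↦ by fin_cases i <;> assumption)
    (fun i ↦ by fin_cases i <;> norm_num)
    (-819) 74529 hb (by norm_num) matrix_surjective

/-- **`Ш(E_{-91/9}/ℚ)[5] = 0`, unconditionally.** [cite: SilvermanAEC2009, Thm. X.4.2(a)] -/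
theorem sha_torsionBy_five_eq_bot :
    haveI := isElliptic
    (kubertTateFive (((-91 : ℤ) : ℚ)) (((9 : ℤ) : ℚ))).sha[((5 : ℕ) : ℤ)] = ⊥ := by
  haveI := isElliptic
  haveI : Fact (Nat.Prime 2) := ⟨Nat.prime_two⟩
  obtain ⟨h1, h2, h3, hb⟩ := nonsingular_points
  exact KubertTateMuDescent.sha_torsionBy_five_eq_bot_of_matrix (-91) 9
    (toGeomPoints _ (.some (-60) 1104 h2)) (fun σ ↦ smul_toGeomPoints _ σ _)
    (KubertTateFiveTorsion.twentyfive_zsmul_toGeomPoints_ne_zero (-91) 9 2 (by norm_num) (by norm_num)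
      not_tor_dvd_Δ (by norm_num) (by norm_num))
    not_five_dvd_Δ tame ![3, 7, 13] primeFactors_enum.1 primeFactors_enum.2
    ![0, -60, -585] ![-7371, 1104, -1521]
    (fun i ↦ by fin_cases i <;> assumption)
    (fun i ↦ by fin_cases i <;> norm_num)
    (-819) 74529 hb (by norm_num) matrix_surjective

/-- **`Ш(E_{-91/9}/ℚ)[5^∞] = 0`, unconditionally.** [cite: SilvermanAEC2009, Thm. X.4.2(a)] -/
theorem primaryComponent_sha_five_eq_bot :
    haveI := isElliptic
    AddCommGroup.primaryComponent (kubertTateFive (((-91 : ℤ) : ℚ)) (((9 : ℤ) : ℚ))).sha 5 = ⊥ := by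
  haveI := isElliptic
  haveI : Fact (Nat.Prime 2) := ⟨Nat.prime_two⟩
  obtain ⟨h1, h2, h3, hb⟩ := nonsingular_points
  exact KubertTateMuDescent.primaryComponent_sha_five_eq_bot_of_matrix (-91) 9
    (toGeomPoints _ (.some (-60) 1104 h2)) (fun σ ↦ smul_toGeomPoints _ σ _)
    (KubertTateFiveTorsion.twentyfive_zsmul_toGeomPoints_ne_zero (-91) 9 2 (by norm_num) (by norm_num)
      not_tor_dvd_Δ (by norm_num) (by norm_num))
    not_five_dvd_Δ tame ![3, 7, 13] primeFactors_enum.1 primeFactors_enum.2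
    ![0, -60, -585] ![-7371, 1104, -1521]
    (fun i ↦ by fin_cases i <;> assumption)
    (fun i ↦ by fin_cases i <;> norm_num)
    (-819) 74529 hb (by norm_num) matrix_surjective

/-- **`rank E_{-91/9}(ℚ) = 2`, unconditionally** (the `5`-descent computes the rank: box full, tame,
`#E(ℚ)[5] = 5` by reduction modulo `2`). [cite: SilvermanAEC2009, Thm. X.4.2 and Thm. X.1.1] -/
theorem mordellWeilRank_eq :
    haveI := isElliptic
    (kubertTateFive (((-91 : ℤ) : ℚ)) (((9 : ℤ) : ℚ))).mordellWeilRank = 2 := by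
  haveI := isElliptic
  haveI : Fact (Nat.Prime 2) := ⟨Nat.prime_two⟩
  obtain ⟨h1, h2, h3, hb⟩ := nonsingular_points
  have h := KubertTateMuDescent.mordellWeilRank_succ_eq_of_matrix (-91) 9
    (toGeomPoints _ (.some (-60) 1104 h2)) (fun σ ↦ smul_toGeomPoints _ σ _)
    (KubertTateFiveTorsion.twentyfive_zsmul_toGeomPoints_ne_zero (-91) 9 2 (by norm_num) (by norm_num)
      not_tor_dvd_Δ (by norm_num) (by norm_num))
    not_five_dvd_Δ tame ![3, 7, 13] primeFactors_enum.1 primeFactors_enum.2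
    ![0, -60, -585] ![-7371, 1104, -1521]
    (fun i ↦ by fin_cases i <;> assumption)
    (fun i ↦ by fin_cases i <;> norm_num)
    (-819) 74529 hb (by norm_num) matrix_surjective
    (KubertTateFiveTorsion.natCard_torsionBy_five (-91) 9 2 (by norm_num) (by norm_num) not_tor_dvd_Δ)
  have hc : (((-91 : ℤ) * 9).natAbs.primeFactors).card = 3 := by
    rw [primeFactors_eq]; decide
  omega

end KubertTateM919Descent

end Literature.NumberTheory.EllipticCurves

end
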